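import Mathlib
import HarnessLib
import Summits.CriticalPhenomena.SAWScalingLimit.Theses.SAWDefectDecoherence
import Literature.Probability.RandomPlanarGeometry.HexDomainSingleton
import Literature.Barriers.CriticalPhenomena.ParafermionicHalfCauchyRiemann

/-!
# `stub_wallExit` forces uniform boundedness of the critical two-point mass
(drefute finding for crux `DefectDecoherence`, stmt-CriticalPhenomena-8549, line `tip-martingale-depth-induction`)

The definitions `xc, star, mass, Deep, Admissible, exitMass, ExitBound, WallExit` below are VERBATIM
copies of those in `Cruxes/DefectDecoherence/Lines/tip-martingale-depth-induction.lean` (which is not a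
library module and cannot be imported).

`exitBound_mass_le_two_mul`: if `ExitBound c β` holds for some `β > 0` (any `c`), then there is a radius
`L₀` such that for every admissible configuration at depth `1` (root `s(u,w)` entering `B(v,1)`) the star
mass `M(Λ, s(u,w), v)` is at most twice the star mass of ANY vertex set `Λ'` agreeing with `Λ` inside the
ball `B(v, L₀)`; in particular (take `Λ' = Λ ∩ B(v,L₀)`, one of finitely many sets) the critical two-point
masses `M(Λ, s(u,w), v)` are bounded uniformly over all admissible `Λ`, hence the `x_c`-two-point
function of the infinite slit plane from the tip of the slit to a nearby star (the monotone limit over the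
admissible slit-balls `B(v,N) \ slit`) is finite.  Finiteness of the planar critical SAW two-point function
is known only conditionally on hyperscaling [cite: MadrasSlade1993, §1.4 p. 21: "If (1.4.14) and the values
given for ν … are true, then it would follow that … G_{z_c}(0,x) = Σ_N c_N(0,x) μ^{-N} is finite in all
dimensions, including d = 2"]; so `stub_wallExit` — for ANY `β > 0`, independently of the threshold `3/4`
and of multi-arm exponents — is at least as hard as that open problem (`wallExit_mass_le_two_mul`).
-/

namespace Summit.CriticalPhenomena.SAWScalingLimit.Cruxes.DefectDecoherence.TipMartingaleDepthInduction.WallExitTwoPoint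

open scoped BigOperators
open Literature.Probability.LatticeModels Literature.Probability.RandomPlanarGeometry.SAW Filter

noncomputable section

/-- `x_c = 1/√(2+√2)` (copy). -/
abbrev xc : ℝ := hexCriticalFugacity

/-- The star of `v` inside `Λ` (copy). -/
def star (Λ : Finset HexVertex) (v : HexVertex) : Finset HexVertex :=
  Λ.filter (fun t => hexGraph.Adj v t)

/-- The star MASS `M(Λ, s(u,w), v)` (copy). -/
def mass (Λ : Finset HexVertex) (u w v : HexVertex) : ℝ :=
  ∑ t ∈ star Λ v, ‖hexParafermionicObservable Λ s(u, w) xc 0 s(v, t)‖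

/-- `v` is `R`-deep in `Λ` (copy). -/
def Deep (Λ : Finset HexVertex) (v : HexVertex) (R : ℝ) : Prop :=
  ∀ y : HexVertex, dist (hexCenter y) (hexCenter v) ≤ R → y ∈ Λ

/-- Admissible configuration at depth `R` (copy). -/
def Admissible (Λ : Finset HexVertex) (u w v : HexVertex) (R : ℝ) : Prop :=
  hexDomainSimplyConnected Λ ∧ hexGraph.Adj u w ∧ u ∉ Λ ∧ w ∈ Λ ∧ 1 ≤ R ∧ Deep Λ v R

/-- EXIT MASS beyond radius `L` (copy). -/
def exitMass (Λ : Finset HexVertex) (u w v : HexVertex) (L : ℝ) : ℝ :=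
  ∑ t ∈ star Λ v, ∑ γ : HexMidEdgeSAW Λ s(u, w) s(v, t),
    if (∃ q ∈ γ.verts, L < dist (hexCenter q) (hexCenter v)) then xc ^ γ.length else 0

/-- WALL–EXIT BOUND with constant `c` and exponent `β` (copy). -/
def ExitBound (c β : ℝ) : Prop :=
  ∀ (Λ : Finset HexVertex) (u w v : HexVertex) (ρ L : ℝ), Admissible Λ u w v ρ →
    dist (hexCenter w) (hexCenter v) ≤ ρ → ρ ≤ L →
      exitMass Λ u w v L ≤ c * (L / ρ) ^ (-β) * mass Λ u w v

/-- S2 statement (copy). -/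
def WallExit : Prop :=
  ∃ c β : ℝ, 3 / 4 < β ∧ 0 ≤ c ∧ ExitBound c β

/-! ### The complementary IN-MASS and the split `mass = exitMass + inMass` -/

/-- Mass of the walks `a → star(v)` all of whose vertices lie within distance `L` of `c_v`. -/
def inMass (Λ : Finset HexVertex) (u w v : HexVertex) (L : ℝ) : ℝ :=
  ∑ t ∈ star Λ v, ∑ γ : HexMidEdgeSAW Λ s(u, w) s(v, t),
    if (∃ q ∈ γ.verts, L < dist (hexCenter q) (hexCenter v)) then 0 else xc ^ γ.length

/-- `0 ≤ x_c`. -/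
theorem xc_nonneg : 0 ≤ xc := hexCriticalFugacity_pos_lt_one.1.le

/-- The star mass is the plain `x_c`-weighted count of walks to the three star mid-edges. -/
theorem mass_eq_sum (Λ : Finset HexVertex) (u w v : HexVertex) :
    mass Λ u w v = ∑ t ∈ star Λ v, ∑ γ : HexMidEdgeSAW Λ s(u, w) s(v, t), xc ^ γ.length := by
  unfold mass
  refine Finset.sum_congr rfl fun t _ => ?_
  rw [hexParafermionicObservable_zero_spin, Complex.norm_real,
    Real.norm_of_nonneg (Finset.sum_nonneg fun γ _ => pow_nonneg xc_nonneg _)]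

/-- `M = exitMass(L) + inMass(L)` for every radius `L`. -/
theorem mass_eq_exitMass_add_inMass (Λ : Finset HexVertex) (u w v : HexVertex) (L : ℝ) :
    mass Λ u w v = exitMass Λ u w v L + inMass Λ u w v L := by
  rw [mass_eq_sum, exitMass, inMass, ← Finset.sum_add_distrib]
  refine Finset.sum_congr rfl fun t _ => ?_
  rw [← Finset.sum_add_distrib]
  refine Finset.sum_congr rfl fun γ _ => ?_
  split_ifs <;> simp

/-- The exit mass is nonnegative. -/
theorem exitMass_nonneg (Λ : Finset HexVertex) (u w v : HexVertex) (L : ℝ) :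
    0 ≤ exitMass Λ u w v L :=
  Finset.sum_nonneg fun _ _ => Finset.sum_nonneg fun _ _ => by
    split_ifs
    · exact pow_nonneg xc_nonneg _
    · exact le_rfl

/-- The star mass is nonnegative. -/
theorem mass_nonneg (Λ : Finset HexVertex) (u w v : HexVertex) : 0 ≤ mass Λ u w v :=
  Finset.sum_nonneg fun _ _ => norm_nonneg _

/-- `inMass(L) ≤ M`. -/
theorem inMass_le_mass (Λ : Finset HexVertex) (u w v : HexVertex) (L : ℝ) :
    inMass Λ u w v L ≤ mass Λ u w v := by
  rw [mass_eq_exitMass_add_inMass Λ u w v L]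
  linarith [exitMass_nonneg Λ u w v L]

/-! ### Lattice geometry: neighbours are at distance `1/√3 ≤ 1` -/

/-- Adjacent honeycomb vertices have centres at squared distance `1/3` (as in the skeleton). -/
theorem normSq_hexCenter_sub_of_adj {v t : HexVertex} (h : hexGraph.Adj v t) :
    Complex.normSq (hexCenter t - hexCenter v) = 1 / 3 := by
  obtain ⟨x, i⟩ := t
  obtain ⟨y, j⟩ := v
  rw [hexCenter_sub_hexCenter, normSq_add_mul_triZeta]
  fin_cases i <;> fin_cases j
  · exact absurd h (Literature.Barriers.CriticalPhenomena.HexKernel.not_hexGraph_adj_of_snd_eq_holds _ _ rfl)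
  · rcases (Literature.Barriers.CriticalPhenomena.HexKernel.hexGraph_adj_iff_of_snd_eq_zero_holds x y).1 h.symm with rfl | rfl | rfl
    · simp; norm_num
    · simp [Pi.sub_apply]; norm_num
    · simp [Pi.sub_apply]; norm_num
  · rcases (Literature.Barriers.CriticalPhenomena.HexKernel.hexGraph_adj_iff_of_snd_eq_zero_holds y x).1 h with rfl | rfl | rfl
    · simp; norm_num
    · simp [Pi.sub_apply]; norm_num
    · simp [Pi.sub_apply]; norm_num
  · exact absurd h (Literature.Barriers.CriticalPhenomena.HexKernel.not_hexGraph_adj_of_snd_eq_holds _ _ rfl)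

/-- Adjacent honeycomb vertices have centres at distance `≤ 1` (exactly `1/√3`). -/
theorem dist_hexCenter_le_one_of_adj {v t : HexVertex} (h : hexGraph.Adj v t) :
    dist (hexCenter t) (hexCenter v) ≤ 1 := by
  rw [dist_eq_norm, ← sq_le_one_iff₀ (norm_nonneg _), Complex.sq_norm, normSq_hexCenter_sub_of_adj h]
  norm_num

/-! ### The in-mass only sees the domain inside the ball -/

/-- A nonzero summand of `inMass` is a near walk. -/
theorem near_of_ne_zero {Λ : Finset HexVertex} {a z : Sym2 HexVertex} {v : HexVertex} {L : ℝ}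
    {γ : HexMidEdgeSAW Λ a z}
    (hne : (if (∃ q ∈ γ.verts, L < dist (hexCenter q) (hexCenter v)) then (0 : ℝ)
      else xc ^ γ.length) ≠ 0) :
    ¬ ∃ q ∈ γ.verts, L < dist (hexCenter q) (hexCenter v) := by
  intro h
  rw [if_pos h] at hne
  exact hne rfl

/-- Transport of a walk all of whose vertices are `L`-close to `v` to a domain agreeing with `Λ` there. -/
def transport {Λ Λ' : Finset HexVertex} {u w v : HexVertex} {z : Sym2 HexVertex} {L : ℝ}
    (hΛ : ∀ y, dist (hexCenter y) (hexCenter v) ≤ L → (y ∈ Λ ↔ y ∈ Λ'))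
    (huw : hexGraph.Adj u w) (hw : w ∈ Λ') (γ : HexMidEdgeSAW Λ s(u, w) z)
    (hγ : ¬ ∃ q ∈ γ.verts, L < dist (hexCenter q) (hexCenter v)) :
    HexMidEdgeSAW Λ' s(u, w) z where
  verts := γ.verts
  subset := by
    intro q hq
    push Not at hγ
    exact (hΛ q (hγ q hq)).1 (γ.subset q hq)
  nodup := γ.nodup
  isChain := γ.isChain
  head_mem := γ.head_mem
  getLast_mem := γ.getLast_mem
  eq_of_nil := γ.eq_of_nil
  edges_nodup := γ.edges_nodup
  fst_mem := ⟨(hexGraph.mem_edgeSet).2 huw, w, Sym2.mem_mk_right u w, hw⟩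

/-- `transport` keeps the vertex list. -/
@[simp] theorem transport_verts {Λ Λ' : Finset HexVertex} {u w v : HexVertex} {z : Sym2 HexVertex}
    {L : ℝ} (hΛ : ∀ y, dist (hexCenter y) (hexCenter v) ≤ L → (y ∈ Λ ↔ y ∈ Λ'))
    (huw : hexGraph.Adj u w) (hw : w ∈ Λ') (γ : HexMidEdgeSAW Λ s(u, w) z)
    (hγ : ¬ ∃ q ∈ γ.verts, L < dist (hexCenter q) (hexCenter v)) :
    (transport hΛ huw hw γ hγ).verts = γ.verts := rfl

/-- `transport` keeps the length. -/
@[simp] theorem transport_length {Λ Λ' : Finset HexVertex} {u w v : HexVertex} {z : Sym2 HexVertex}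
    {L : ℝ} (hΛ : ∀ y, dist (hexCenter y) (hexCenter v) ≤ L → (y ∈ Λ ↔ y ∈ Λ'))
    (huw : hexGraph.Adj u w) (hw : w ∈ Λ') (γ : HexMidEdgeSAW Λ s(u, w) z)
    (hγ : ¬ ∃ q ∈ γ.verts, L < dist (hexCenter q) (hexCenter v)) :
    (transport hΛ huw hw γ hγ).length = γ.length := rfl

/-- The in-mass of two vertex sets agreeing within distance `L ≥ 1` of `v` coincide. -/
theorem inMass_congr {Λ Λ' : Finset HexVertex} {u w v : HexVertex} {L : ℝ}
    (hΛ : ∀ y, dist (hexCenter y) (hexCenter v) ≤ L → (y ∈ Λ ↔ y ∈ Λ'))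
    (huw : hexGraph.Adj u w) (hw : w ∈ Λ) (hw' : w ∈ Λ') (hL : 1 ≤ L) :
    inMass Λ u w v L = inMass Λ' u w v L := by
  have hΛ' : ∀ y, dist (hexCenter y) (hexCenter v) ≤ L → (y ∈ Λ' ↔ y ∈ Λ) :=
    fun y hy => (hΛ y hy).symm
  have hstar : star Λ v = star Λ' v := by
    ext t
    simp only [star, Finset.mem_filter]
    constructor
    · rintro ⟨ht, hadj⟩
      exact ⟨(hΛ t ((dist_hexCenter_le_one_of_adj hadj).trans hL)).1 ht, hadj⟩
    · rintro ⟨ht, hadj⟩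
      exact ⟨(hΛ t ((dist_hexCenter_le_one_of_adj hadj).trans hL)).2 ht, hadj⟩
  unfold inMass
  rw [hstar]
  refine Finset.sum_congr rfl fun t _ => ?_
  refine Finset.sum_bij_ne_zero (fun γ _ hne => transport hΛ huw hw' γ (near_of_ne_zero hne))
    (fun _ _ _ => Finset.mem_univ _) ?_ ?_ ?_
  · intro γ₁ _ _ γ₂ _ _ h
    exact HexMidEdgeSAW.ext (by simpa using congrArg HexMidEdgeSAW.verts h)
  · intro γ' _ hne'
    refine ⟨transport hΛ' huw hw γ' (near_of_ne_zero hne'), Finset.mem_univ _, ?_, ?_⟩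
    · simpa using hne'
    · exact HexMidEdgeSAW.ext rfl
  · intro γ _ hne
    have hγ := near_of_ne_zero hne
    simp [hγ]

/-! ### Main result -/

/-- **`ExitBound` forces locality (hence uniform boundedness) of the critical star mass.**  If
`ExitBound c β` with `β > 0` (any real `c`), there is `L₀ ≥ 1` such that for every configuration admissible at
depth `1` whose root enters `B(v,1)` and every vertex set `Λ'` agreeing with `Λ` on `B(v, L₀)`:
`M(Λ, s(u,w), v) ≤ 2 M(Λ', s(u,w), v)`. -/
theorem exitBound_mass_le_two_mul {c β : ℝ} (hβ : 0 < β) (hE : ExitBound c β) :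
    ∃ L₀ : ℝ, 1 ≤ L₀ ∧ ∀ (Λ Λ' : Finset HexVertex) (u w v : HexVertex),
      Admissible Λ u w v 1 → dist (hexCenter w) (hexCenter v) ≤ 1 →
      (∀ y, dist (hexCenter y) (hexCenter v) ≤ L₀ → (y ∈ Λ ↔ y ∈ Λ')) →
        mass Λ u w v ≤ 2 * mass Λ' u w v := by
  -- choose L₀ ≥ 1 with c L₀^{-β} ≤ 1/2
  have h1 : ∀ᶠ L : ℝ in atTop, c * L ^ (-β) ≤ 1 / 2 := by
    have ht : Tendsto (fun L : ℝ => c * L ^ (-β)) atTop (nhds (c * 0)) :=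
      (tendsto_rpow_neg_atTop hβ).const_mul c
    rw [mul_zero] at ht
    exact ht.eventually (eventually_le_nhds (by norm_num : (0 : ℝ) < 1 / 2))
  obtain ⟨L₀, hL₀c, hL₀1⟩ := (h1.and (eventually_ge_atTop 1)).exists
  refine ⟨L₀, hL₀1, ?_⟩
  intro Λ Λ' u w v hadm hwv hΛ
  have huw : hexGraph.Adj u w := hadm.2.1
  have hw : w ∈ Λ := hadm.2.2.2.1
  have hw' : w ∈ Λ' := (hΛ w (hwv.trans hL₀1)).1 hw
  have hexit : exitMass Λ u w v L₀ ≤ c * (L₀ / 1) ^ (-β) * mass Λ u w v :=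
    hE Λ u w v 1 L₀ hadm hwv hL₀1
  rw [div_one] at hexit
  have hhalf : exitMass Λ u w v L₀ ≤ 1 / 2 * mass Λ u w v :=
    hexit.trans (mul_le_mul_of_nonneg_right hL₀c (mass_nonneg Λ u w v))
  have hsplit := mass_eq_exitMass_add_inMass Λ u w v L₀
  have hin : inMass Λ u w v L₀ = inMass Λ' u w v L₀ := inMass_congr hΛ huw hw hw' hL₀1
  have hin' : inMass Λ' u w v L₀ ≤ mass Λ' u w v := inMass_le_mass Λ' u w v L₀
  linarith

/-- **Corollary for the stub.** `WallExit` (S2 of the line, any admissible exponent) implies the same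
locality/uniform-boundedness of the critical two-point star mass — a statement whose truth is the
(conjectural, hyperscaling-conditional) finiteness of the planar critical SAW two-point function. -/
theorem wallExit_mass_le_two_mul (h : WallExit) :
    ∃ L₀ : ℝ, 1 ≤ L₀ ∧ ∀ (Λ Λ' : Finset HexVertex) (u w v : HexVertex),
      Admissible Λ u w v 1 → dist (hexCenter w) (hexCenter v) ≤ 1 →
      (∀ y, dist (hexCenter y) (hexCenter v) ≤ L₀ → (y ∈ Λ ↔ y ∈ Λ')) →
        mass Λ u w v ≤ 2 * mass Λ' u w v := by
  obtain ⟨c, β, hβ, -, hE⟩ := h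
  exact exitBound_mass_le_two_mul (by linarith) hE

end

end Summit.CriticalPhenomena.SAWScalingLimit.Cruxes.DefectDecoherence.TipMartingaleDepthInduction.WallExitTwoPoint
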